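import Mathlib
import HarnessLib

/-!
# N4 / T1 piece W1 — TOOLS for the energy identity of LIPSCHITZ generalized supersolutions
# (admissibility of the test `−H′(V)Θ²ηχ`, Rademacher slices, time integration by parts)

Route `AxisTwistDoor`, crux `AveragedConeLiouville` (stmt-NavierStokesRegularity-26889), INPUT N4 / T1
= the typed fact `Literature.Analysis.FluidPDE.NazarovUraltseva2011_positivity_propagation (ℝ³)`
(Nazarov–Ural'tseva 2011 §3; Lipschitz generalized supersolutions, p. 2–3 / p. 8 of arXiv:1011.1888),
programme `kits/N4-T1-skeleton.lean` (118454bf17607d1e), piece W1 `Sig.nu_weakEnergyIdentity`.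
Folklore tools, all about Lipschitz functions on `ℝ × ℝ³` (or a metric space):

* `lipschitzWith_mul_of_eq_zero_off` — `F·G` is globally Lipschitz when `G` is Lipschitz, bounded and
  vanishes off a set `K` on which `F` is Lipschitz and bounded (admissibility of the test function
  `−H′(V)·Θ²ηχ` of N–U, whose first factor is only controlled on the cylinder);
* `hasFDerivAt_slice_of_differentiableAt`, `hasDerivAt_timeLine_of_differentiableAt` — at a point
  of (joint) differentiability the slice and the time line are differentiable, with the restricted
  derivatives (used a.e. through Rademacher, `LipschitzWith.ae_differentiableAt`);
* `lineDeriv_inl_eq_deriv_timeLine` — the line derivative along `(1,0)` is the time derivative;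
* `integral_timeDeriv_mul_eq_neg` — ∫ ∂ₜF · G = −∫ F · ∂ₜG on `ℝ × ℝ³` for Lipschitz `F`, `G` with `G`
  compactly supported (Mathlib's `integral_lineDeriv_mul_eq` along `(1,0)` + Rademacher for `G`).

WHAT THIS IS NOT: not a statement about Navier–Stokes; T1 is an INPUT; item 26889 and the summit
stay open. [cite: NazarovUraltseva2011HarnackDivFree, §1 p. 2–3 and §3 p. 8 (arXiv:1011.1888)]
-/

noncomputable section

-- the summit and its single sub-problem share the name (CONVENTIONS §1)
set_option linter.dupNamespace false

open MeasureTheory Set Function Filter Topology Metric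
open scoped NNReal ENNReal

namespace Summit.NavierStokesRegularity.NavierStokesRegularity.Theorems.AveragedConeLiouville.NUPositivity

/-! ### Products of Lipschitz functions, one of them vanishing off a set -/

/-- **A product `F·G` is globally Lipschitz** when `G` is `CG`-Lipschitz, bounded by `MG` and vanishes
off `K`, and `F` is `CF`-Lipschitz on `K` and bounded by `MF` on `K` (no control of `F` off `K` is
needed). [folklore] -/
theorem lipschitzWith_mul_of_eq_zero_off {X : Type*} [PseudoMetricSpace X] {F G : X → ℝ} {K : Set X}
    {CF CG : ℝ≥0} {MF MG : ℝ} (hG : LipschitzWith CG G) (hGb : ∀ x, |G x| ≤ MG)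
    (hG0 : ∀ x, x ∉ K → G x = 0) (hF : LipschitzOnWith CF F K) (hFb : ∀ x ∈ K, |F x| ≤ MF)
    (hMF : 0 ≤ MF) (hMG : 0 ≤ MG) :
    LipschitzWith (⟨MF, hMF⟩ * CG + ⟨MG, hMG⟩ * CF) (fun x => F x * G x) := by
  have hGd : ∀ p q, |G p - G q| ≤ CG * dist p q := fun p q => by
    rw [← Real.dist_eq]; exact hG.dist_le_mul p q
  have hFd : ∀ p ∈ K, ∀ q ∈ K, |F p - F q| ≤ CF * dist p q := fun p hp q hq => by
    rw [← Real.dist_eq]; exact (lipschitzOnWith_iff_dist_le_mul.1 hF) p hp q hq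
  refine LipschitzWith.of_dist_le_mul fun p q => ?_
  rw [Real.dist_eq]
  have hcoe : ((⟨MF, hMF⟩ * CG + ⟨MG, hMG⟩ * CF : ℝ≥0) : ℝ) = MF * CG + MG * CF := by
    simp only [NNReal.coe_add, NNReal.coe_mul]
    rfl
  rw [hcoe]
  have hd : 0 ≤ dist p q := dist_nonneg
  by_cases hp : p ∈ K
  · by_cases hq : q ∈ K
    · -- both in `K`
      have e : F p * G p - F q * G q = F p * (G p - G q) + G q * (F p - F q) := by ring
      rw [e]
      calc |F p * (G p - G q) + G q * (F p - F q)|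
          ≤ |F p| * |G p - G q| + |G q| * |F p - F q| := by
            refine (abs_add_le _ _).trans ?_; rw [abs_mul, abs_mul]
        _ ≤ MF * (CG * dist p q) + MG * (CF * dist p q) :=
            add_le_add (mul_le_mul (hFb p hp) (hGd p q) (abs_nonneg _) hMF)
              (mul_le_mul (hGb q) (hFd p hp q hq) (abs_nonneg _) hMG)
        _ = (MF * CG + MG * CF) * dist p q := by ring
    · rw [hG0 q hq, mul_zero, sub_zero, abs_mul]
      have h1 : |G p| = |G p - G q| := by rw [hG0 q hq, sub_zero]
      rw [h1]
      calc |F p| * |G p - G q| ≤ MF * (CG * dist p q) :=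
            mul_le_mul (hFb p hp) (hGd p q) (abs_nonneg _) hMF
        _ ≤ (MF * CG + MG * CF) * dist p q := by nlinarith [mul_nonneg hMG (mul_nonneg CF.coe_nonneg hd)]
  · by_cases hq : q ∈ K
    · rw [hG0 p hp, mul_zero, zero_sub, abs_neg, abs_mul]
      have h1 : |G q| = |G p - G q| := by rw [hG0 p hp, zero_sub, abs_neg]
      rw [h1]
      calc |F q| * |G p - G q| ≤ MF * (CG * dist p q) :=
            mul_le_mul (hFb q hq) (hGd p q) (abs_nonneg _) hMF
        _ ≤ (MF * CG + MG * CF) * dist p q := by nlinarith [mul_nonneg hMG (mul_nonneg CF.coe_nonneg hd)]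
    · rw [hG0 p hp, hG0 q hq, mul_zero, mul_zero, sub_zero, abs_zero]
      positivity

/-! ### Rademacher slices: derivatives of slices and time lines at a point of differentiability -/

/-- At a point of differentiability of `g : ℝ × ℝ³ → F`, the spatial slice is differentiable with
derivative `Dg(p) ∘ (0, ·)`. [folklore] -/
theorem hasFDerivAt_slice_of_differentiableAt {F : Type*} [NormedAddCommGroup F] [NormedSpace ℝ F]
    {g : ℝ × EuclideanSpace ℝ (Fin 3) → F} {p : ℝ × EuclideanSpace ℝ (Fin 3)}
    (hg : DifferentiableAt ℝ g p) :
    HasFDerivAt (fun x => g (p.1, x)) ((fderiv ℝ g p).comp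
      (ContinuousLinearMap.inr ℝ ℝ (EuclideanSpace ℝ (Fin 3)))) p.2 := by
  have h1 : HasFDerivAt g (fderiv ℝ g p) (p.1, p.2) := hg.hasFDerivAt
  exact h1.comp p.2 (hasFDerivAt_prodMk_right p.1 p.2)

/-- At a point of differentiability of `g : ℝ × ℝ³ → F`, the time line is differentiable with
derivative `Dg(p)(1,0)`. [folklore] -/
theorem hasDerivAt_timeLine_of_differentiableAt {F : Type*} [NormedAddCommGroup F] [NormedSpace ℝ F]
    {g : ℝ × EuclideanSpace ℝ (Fin 3) → F} {p : ℝ × EuclideanSpace ℝ (Fin 3)}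
    (hg : DifferentiableAt ℝ g p) :
    HasDerivAt (fun s => g (s, p.2)) (fderiv ℝ g p ((1 : ℝ), (0 : EuclideanSpace ℝ (Fin 3)))) p.1 := by
  have h1 : HasFDerivAt g (fderiv ℝ g p) (p.1, p.2) := hg.hasFDerivAt
  have h2 := (h1.comp p.1 (hasFDerivAt_prodMk_left p.1 p.2)).hasDerivAt
  have e : (g ∘ fun s : ℝ => (s, p.2)) = fun s => g (s, p.2) := rfl
  rw [e] at h2
  simpa using h2

/-- The line derivative along `(1,0)` is the derivative of the time line. [folklore] -/
theorem lineDeriv_inl_eq_deriv_timeLine {F : Type*} [NormedAddCommGroup F] [NormedSpace ℝ F]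
    (g : ℝ × EuclideanSpace ℝ (Fin 3) → F) (p : ℝ × EuclideanSpace ℝ (Fin 3)) :
    lineDeriv ℝ g p ((1 : ℝ), (0 : EuclideanSpace ℝ (Fin 3))) = deriv (fun s => g (s, p.2)) p.1 := by
  rw [lineDeriv]
  have e : (fun t : ℝ => g (p + t • ((1 : ℝ), (0 : EuclideanSpace ℝ (Fin 3))))) =
      fun t => (fun s => g (s, p.2)) (t + p.1) := by
    funext t
    have : p + t • ((1 : ℝ), (0 : EuclideanSpace ℝ (Fin 3))) = (t + p.1, p.2) := by
      ext <;> simp [add_comm]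
    rw [this]
  rw [e, deriv_comp_add_const (f := fun s => g (s, p.2)) (a := p.1) (x := (0 : ℝ)), zero_add]

/-! ### Time integration by parts on `ℝ × ℝ³` for Lipschitz functions -/

/-- **∫ ∂ₜF · G = −∫ F · ∂ₜG on `ℝ × ℝ³`** for `F`, `G` Lipschitz with `G` compactly supported (the
derivatives exist a.e. by Rademacher; Mathlib's integration by parts for line derivatives of
Lipschitz functions along `v = (1,0)`). [folklore] -/
theorem integral_timeDeriv_mul_eq_neg {F G : ℝ × EuclideanSpace ℝ (Fin 3) → ℝ} {C D : ℝ≥0}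
    (hF : LipschitzWith C F) (hG : LipschitzWith D G) (hGc : HasCompactSupport G) :
    ∫ p, deriv (fun s => F (s, p.2)) p.1 * G p =
      -∫ p, F p * deriv (fun s => G (s, p.2)) p.1 := by
  haveI : (volume : Measure (ℝ × EuclideanSpace ℝ (Fin 3))).IsAddHaarMeasure := by
    change ((volume : Measure ℝ).prod (volume : Measure (EuclideanSpace ℝ (Fin 3)))).IsAddHaarMeasure
    infer_instance
  set v : ℝ × EuclideanSpace ℝ (Fin 3) := ((1 : ℝ), (0 : EuclideanSpace ℝ (Fin 3))) with hv
  have h := LipschitzWith.integral_lineDeriv_mul_eq (μ := (volume : Measure (ℝ × EuclideanSpace ℝ (Fin 3))))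
    hF hG hGc v
  have e1 : (fun p : ℝ × EuclideanSpace ℝ (Fin 3) => lineDeriv ℝ F p v * G p) =
      fun p => deriv (fun s => F (s, p.2)) p.1 * G p := by
    funext p; rw [hv, lineDeriv_inl_eq_deriv_timeLine]
  -- `lineDeriv G p (-v) = - lineDeriv G p v` at every point of differentiability of `G` (a.e.)
  have e2 : (fun p : ℝ × EuclideanSpace ℝ (Fin 3) => lineDeriv ℝ G p (-v) * F p) =ᵐ[volume]
      fun p => -(F p * deriv (fun s => G (s, p.2)) p.1) := by
    filter_upwards [hG.ae_differentiableAt (μ := volume)] with p hp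
    rw [hp.lineDeriv_eq_fderiv, map_neg, ← hp.lineDeriv_eq_fderiv, hv, lineDeriv_inl_eq_deriv_timeLine]
    ring
  rw [e1] at h
  rw [h, integral_congr_ae e2, integral_neg]

end Summit.NavierStokesRegularity.NavierStokesRegularity.Theorems.AveragedConeLiouville.NUPositivity

end
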